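import Literature.AlgebraicGeometry.Resolution.GenericFormMissesFibreComponents
import HarnessLib

/-!
# Generic members of a base-point-free linear system have no common zero

Topic: `Literature/AlgebraicGeometry/Resolution`. The first genericity statement behind de
Jong's choice of the projection in the proof of Lemma 4.11 (de Jong 1996, p. 68: "To construct
such a `π`, we choose an embedding `X ↪ ℙ^N` and we let `π` be the composition of projection
morphisms as in 2.11", read with forms of high degree as in the tree's projective Noether
normalisation `Motives/ProjectiveNoetherNormalization`): **`r + 1 ≥ dim X + 1` general members
of a base-point-free linear system on `X` have no common zero** — the classical dimension count
"the members through a point form a hyperplane in the parameter space, so the tuples with a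
common zero sweep out a subset of dimension `≤ dim X + (r + 1)(M - 1) < (r + 1) M`"
(Hartshorne, *Algebraic Geometry*, proof of II Thm. 8.18; Görtz–Wedhorn I, proof of
Thm. 13.89). Affine, chart-wise form over an algebraically closed field `k`
(`exists_ne_zero_forall_exists_sum_smul_notMem`):

Let `A` be a finitely generated `k`-algebra with `dim A ≤ e`, `c : σ → A` finitely many
functions WITHOUT common zero at the closed points (`∀ 𝔪` maximal, some `c_μ ∉ 𝔪` — the linear
system is base-point free on `Spec A`), and `r ≥ e`. Then there is a non-zero polynomial
`h ∈ k[T_{j,μ} : j ≤ r, μ ∈ σ]` in the coefficients of `r + 1` members `g_j = Σ_μ a_{j,μ} c_μ` such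
that whenever `h(a) ≠ 0`, the `g_j(a)` have no common zero at any closed point of `Spec A`.

Proof: generic avoidance (`Literature.RingTheory.KrullDimension.exists_ne_zero_forall_mem_of_isMaximal`,
Matsumura Thm. 15.1 + 5.6) for the incidence `V(g₀, …, g_r) ⊆ Spec A × 𝔸^{(r+1)σ}`: over a closed
point `𝔪` with residue values `κ_μ ∈ k` of the `c_μ` (not all zero), the bad parameters lie in
the kernel of the linear map `a ↦ (Σ_μ a_{j,μ} κ_μ)_j`, which is SURJECTIVE onto `k^{r+1}`, so of
codimension `r + 1 ≥ e + 1` (`linIdeal`, `ringKrullDim_quotient_linIdeal_add_le`).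

## References

* A. J. de Jong, *Smoothness, semi-stability and alterations*, Publ. Math. IHÉS 83 (1996), 2.11
  (p. 56) and the proof of Lemma 4.11 (p. 68). [DeJong1996]
* R. Hartshorne, *Algebraic Geometry*, GTM 52 (1977), II Thm. 8.18 (proof). [Hartshorne1977]
* H. Matsumura, *Commutative Ring Theory* (1986), Thm. 15.1, Thm. 5.6. [Matsumura1987]
-/

noncomputable section

open MvPolynomial

namespace Literature.AlgebraicGeometry.Resolution

universe u v

section NoCommonZero

variable (k : Type u) [Field k] [IsAlgClosed k] {A : Type u} [CommRing A] [Algebra k A]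
  [Algebra.FiniteType k A] {σ : Type v} [Fintype σ] [DecidableEq σ] (c : σ → A)

/-- The universal members `g_j = Σ_μ T_{j,μ} c_μ ∈ A[T]`, `j ≤ r`. [folklore] -/
def univMember (r : ℕ) (j : Fin (r + 1)) : MvPolynomial (Fin (r + 1) × σ) A :=
  ∑ μ, X (j, μ) * C (c μ)

omit [IsAlgClosed k] [Algebra.FiniteType k A] [DecidableEq σ] in
/-- `g_j(a) = Σ_μ a_{j,μ} c_μ`. [folklore] -/
theorem evalParams_univMember (r : ℕ) (j : Fin (r + 1)) (a : Fin (r + 1) × σ → k) :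
    evalParams k a (univMember c r j) = ∑ μ, a (j, μ) • c μ := by
  simp [univMember, evalParams, map_sum, Algebra.smul_def]

include k in
/-- **`r + 1 > dim` general members of a base-point-free linear system have no common zero**
(affine form). Let `k` be algebraically closed, `A` a finitely generated `k`-algebra with
`dim A ≤ e ≤ r`, and `c : σ → A` finitely many functions such that at every closed point of
`Spec A` some `c_μ` does not vanish. Then for some non-zero `h ∈ k[T_{j,μ}]`: whenever
`h(a) ≠ 0`, for every maximal ideal `𝔪` some member `Σ_μ a_{j,μ} c_μ`, `j ≤ r`, is not in `𝔪`.
[cite: Hartshorne1977, II Thm. 8.18 (proof)] [cite: Matsumura1987, Thm. 15.1 (i) and Thm. 5.6] -/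
theorem exists_ne_zero_forall_exists_sum_smul_notMem (e : ℕ) (hA : ringKrullDim A ≤ e)
    (hc : ∀ 𝔪 : Ideal A, 𝔪.IsMaximal → ∃ μ, c μ ∉ 𝔪) (r : ℕ) (hr : e ≤ r) :
    ∃ h : MvPolynomial (Fin (r + 1) × σ) k, h ≠ 0 ∧
      ∀ a : Fin (r + 1) × σ → k, eval a h ≠ 0 →
        ∀ 𝔪 : Ideal A, 𝔪.IsMaximal → ∃ j : Fin (r + 1), (∑ μ, a (j, μ) • c μ) ∉ 𝔪 := by
  classical
  haveI : Algebra.FiniteType k (MvPolynomial (Fin (r + 1) × σ) A) :=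
    (inferInstance : Algebra.FiniteType k A).trans inferInstance
  -- the incidence ideal `J = (g₀, …, g_r)`
  set J : Ideal (MvPolynomial (Fin (r + 1) × σ) A) :=
    Ideal.span (Set.range (univMember c r)) with hJ
  have hgJ : ∀ j, univMember c r j ∈ J := fun j => Ideal.subset_span (Set.mem_range_self j)
  -- the fibre hypothesis of generic avoidance over a closed point `𝔪`
  have hfib : ∀ 𝔪 : Ideal A, 𝔪.IsMaximal →
      ∃ s : Finset (Ideal (MvPolynomial (Fin (r + 1) × σ) k)),
        (∀ 𝔟 ∈ s, ringKrullDim (MvPolynomial (Fin (r + 1) × σ) k ⧸ 𝔟) + (e + 1 : ℕ) ≤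
          Nat.card (Fin (r + 1) × σ)) ∧
        ∀ 𝔐 : Ideal (MvPolynomial (Fin (r + 1) × σ) A), 𝔐.IsMaximal → J ≤ 𝔐 →
          𝔐.comap (C : A →+* MvPolynomial (Fin (r + 1) × σ) A) = 𝔪 →
            ∃ 𝔟 ∈ s, 𝔟.map (MvPolynomial.map (algebraMap k A)) ≤ 𝔐 := by
    intro 𝔪 h𝔪
    -- residue values `κ_μ ∈ k` of the `c_μ` at `𝔪`, not all zero
    have hκ' := fun μ =>
      Literature.RingTheory.KrullDimension.exists_sub_algebraMap_mem_of_isMaximal k 𝔪 (c μ)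
    choose κ hκ using hκ'
    obtain ⟨μ₀, hμ₀⟩ := hc 𝔪 h𝔪
    have hκ₀ : κ μ₀ ≠ 0 := by
      intro h0
      apply hμ₀
      have := hκ μ₀
      rwa [h0, map_zero, sub_zero] at this
    -- the linear map `a ↦ (Σ_μ a_{j,μ} κ_μ)_j`, surjective onto `k^{r+1}`
    let Λ : (Fin (r + 1) × σ → k) →ₗ[k] (Fin (r + 1) → k) :=
      { toFun := fun a j => ∑ μ, a (j, μ) * κ μ
        map_add' := fun a b => by
          funext j
          simp only [Pi.add_apply, add_mul, Finset.sum_add_distrib]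
        map_smul' := fun t a => by
          funext j
          simp only [Pi.smul_apply, smul_eq_mul, RingHom.id_apply, Finset.mul_sum, mul_assoc] }
    have hΛ : ∀ a j, Λ a j = ∑ μ, a (j, μ) * κ μ := fun a j => rfl
    have hΛsurj : Function.Surjective Λ := by
      intro v
      refine ⟨fun p => if p.2 = μ₀ then v p.1 / κ μ₀ else 0, funext fun j => ?_⟩
      rw [hΛ, Finset.sum_eq_single μ₀]
      · simp [hκ₀]
      · intro μ _ hμ
        simp [hμ]
      · intro h
        exact absurd (Finset.mem_univ μ₀) h
    have hrank : e + 1 ≤ Module.finrank k (LinearMap.range Λ) := by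
      rw [LinearMap.range_eq_top.mpr hΛsurj, finrank_top, Module.finrank_fintype_fun_eq_card,
        Fintype.card_fin]
      omega
    refine ⟨{Literature.RingTheory.KrullDimension.linIdeal Λ}, ?_, ?_⟩
    · intro 𝔟 h𝔟
      rw [Finset.mem_singleton] at h𝔟
      subst h𝔟
      have := Literature.RingTheory.KrullDimension.ringKrullDim_quotient_linIdeal_add_le Λ hrank
      rwa [← Nat.card_eq_fintype_card] at this
    · intro 𝔐 h𝔐 hJ𝔐 h𝔐𝔪
      -- coordinates `a` of the closed point `𝔐`
      have ha' := fun p =>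
        Literature.RingTheory.KrullDimension.exists_sub_algebraMap_mem_of_isMaximal k 𝔐
          (X p : MvPolynomial (Fin (r + 1) × σ) A)
      choose a ha using ha'
      have hX : ∀ p, X p - C (algebraMap k A (a p)) ∈ 𝔐 := fun p => by
        rw [← MvPolynomial.algebraMap_apply]; exact ha p
      have h𝔐eq : 𝔐 = 𝔪.comap (evalParams k a) := by
        rw [← h𝔐𝔪]; exact eq_comap_eval_comap_C _ hX
      -- every member vanishes at `(𝔪, a)`: `Σ_μ a_{j,μ} c_μ ∈ 𝔪`, hence `Λ a = 0`
      have hg : ∀ j, ∑ μ, a (j, μ) • c μ ∈ 𝔪 := fun j => by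
        rw [← evalParams_univMember k c r j a, ← Ideal.mem_comap, ← h𝔐eq]
        exact hJ𝔐 (hgJ j)
      have hker : Λ a = 0 := by
        funext j
        rw [hΛ, Pi.zero_apply]
        -- map to `A/𝔪`, where `k` embeds
        letI := Ideal.Quotient.field 𝔪
        apply (algebraMap k (A ⧸ 𝔪)).injective
        rw [map_zero, map_sum]
        -- `algebraMap k (A/𝔪) t = mk (algebraMap k A t)`
        have hak : ∀ t : k, algebraMap k (A ⧸ 𝔪) t = Ideal.Quotient.mk 𝔪 (algebraMap k A t) :=
          fun t => rfl
        have h1 : ∀ μ, algebraMap k (A ⧸ 𝔪) (a (j, μ) * κ μ) =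
            Ideal.Quotient.mk 𝔪 (a (j, μ) • c μ) := fun μ => by
          rw [map_mul, Algebra.smul_def, map_mul, hak, hak]
          congr 1
          rw [eq_comm, ← sub_eq_zero, ← map_sub, Ideal.Quotient.eq_zero_iff_mem]
          exact hκ μ
        simp_rw [h1, ← map_sum]
        exact Ideal.Quotient.eq_zero_iff_mem.mpr (hg j)
      refine ⟨Literature.RingTheory.KrullDimension.linIdeal Λ, Finset.mem_singleton_self _, ?_⟩
      have hle := Literature.RingTheory.KrullDimension.linIdeal_le_ker_eval Λ hker
      rw [Ideal.map_le_iff_le_comap]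
      intro q hq
      rw [Ideal.mem_comap, h𝔐eq, Ideal.mem_comap, evalParams_map_algebraMap,
        (RingHom.mem_ker.mp (hle hq)), map_zero]
      exact zero_mem _
  -- generic avoidance
  obtain ⟨h, hh0, hh⟩ :=
    Literature.RingTheory.KrullDimension.exists_ne_zero_forall_mem_of_isMaximal k e hA J hfib
  refine ⟨h, hh0, fun a ha 𝔪 h𝔪 => ?_⟩
  by_contra hall
  push Not at hall
  -- the closed point `(𝔪, a)` lies on the incidence, so `h(a) ∈ 𝔪`, a unit: contradiction
  haveI : (𝔪.comap (evalParams k a)).IsMaximal :=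
    Ideal.comap_isMaximal_of_surjective _ (evalParams_surjective k a)
  have hJ𝔐 : J ≤ 𝔪.comap (evalParams k a) := by
    rw [hJ, Ideal.span_le]
    rintro _ ⟨j, rfl⟩
    rw [SetLike.mem_coe, Ideal.mem_comap, evalParams_univMember]
    exact hall j
  have h1 := hh _ this hJ𝔐
  rw [Ideal.mem_comap, evalParams_map_algebraMap] at h1
  exact h𝔪.ne_top (Ideal.eq_top_of_isUnit_mem _ h1 ((IsUnit.mk0 _ ha).map _))

end NoCommonZero

end Literature.AlgebraicGeometry.Resolution

end
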